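import Summits.CriticalPhenomena.PercolationContinuityZ3.Theorems.PercNearOneGluingNoHeavyQuantScaleDefect
import Summits.CriticalPhenomena.PercolationContinuityZ3.Theorems.PercNearOneGluingNoHeavyQuantThetaModulusR4
import HarnessLib

/-!
# Scale defect at `p_c` ⇒ explicit modulus of continuity of `θ` at `p_c⁺` (quant lane: S-T2 ∘ R4, the
# "T2-weak" corollary of the explicit-rate programme in closed form)

builds on p205010 (kernel theorem, internal audit signed; external expert review pending).
Status sentence for p205010: "θ(p_c) = 0 on ℤ^d, all d ≥ 2 — kernel-verified (Lean 4/Mathlib, standard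
axioms); internal adversarial audit SIGNED 2026-08-20 04:29Z; external expert review pending."

Seat `prim-quant-p4`, `--supports stmt-CriticalPhenomena-4575`; pure proofs (compositions).  MEMO-LEVEL programme (LADDER R5):
the hypothesis `Quant.ScaleDefectAt d (criticalProbI d) L η` (S-T1) is the programme's target S-T3, NOT yet a theorem; an explicit
function tending to 0 and nothing more.

* `oneArmRateAtCritical_of_scaleDefect` — S-T2 (`Quant.oneArmRate_of_scaleDefect`, p3/stmt) packaged as
  `Quant.OneArmRateAtCritical d (N ↦ (1 − η)^{iterCount L N})` (`0 < η ≤ 1`, `L` above the identity; `iterCount L N → ∞`).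
* `thetaModulusNearCritical_of_scaleDefect` — composed with R4 (`ThetaModulus.thetaModulusNearCritical_of_oneArmRate`):
  `Quant.ThetaModulusNearCritical d ω` for the explicit
  `ω(t) = inf_n ( √((1 − η)^{iterCount L (n+1)}) + t·√(#E(Λ_{n+1})/(2 p_c (1 − p_c))) )²` on `t ≤ (1 − p_c)/2` (`1` beyond).
  So once S-T3 `criticalScaleDefect : ScaleDefectAt d (criticalProbI d) (lHi d) (eta1 d)` lands, `thetaModulus_explicit` is this theorem
  applied to it (one line), with every constant closed-form.
-/

noncomputable section

namespace Summit.CriticalPhenomena.PercolationContinuityZ3.Theorems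

namespace ThetaModulus

open MeasureTheory Set Filter Topology Literature.Probability.Percolation Literature.Probability.LatticeModels
open scoped Classical

variable {d : ℕ}

/-- **S-T2 as a `Quant.OneArmRateAtCritical` instance**: a scale defect `η ∈ (0, 1]` at `p_c` along a scale function `L` above the
identity gives the explicit critical one-arm rate `f(N) = (1 − η)^{iterCount L N} → 0`.  (Bound: `Quant.oneArmRate_of_scaleDefect`;
limit: `Quant.tendsto_iterCount_atTop` and `0 ≤ 1 − η < 1`.)  MEMO-LEVEL programme; conditional on the scale defect.
builds on p205010 (kernel theorem, internal audit signed; external expert review pending). -/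
theorem oneArmRateAtCritical_of_scaleDefect {L : ℕ → ℕ} {η : ℝ}
    (h : Quant.ScaleDefectAt d (criticalProbI d) L η) (hη0 : 0 < η) (hη1 : η ≤ 1) (hL : ∀ m, m ≤ L m) :
    Quant.OneArmRateAtCritical d (fun N => (1 - η) ^ Quant.iterCount L N) := by
  refine ⟨?_, fun N _ => Quant.oneArmRate_of_scaleDefect h hL N⟩
  have hpow : Tendsto (fun j : ℕ => (1 - η) ^ j) atTop (𝓝 0) :=
    tendsto_pow_atTop_nhds_zero_of_lt_one (by linarith) (by linarith)
  exact hpow.comp (Quant.tendsto_iterCount_atTop L)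

/-- **Scale defect at `p_c` ⇒ explicit modulus (S-T2 ∘ R4).**  Under `Quant.ScaleDefectAt d (criticalProbI d) L η` with
`0 < η ≤ 1`, `L` above the identity and `d ≥ 2`:  `Quant.ThetaModulusNearCritical d ω` with
`ω(t) = inf_n (√((1−η)^{iterCount L (n+1)}) + t·√(#E(Λ_{n+1})/(2p_c(1−p_c))))²` for `t ≤ (1−p_c)/2` and `ω(t) = 1` beyond — every
ingredient closed-form in `(d, L, η, p_c)`.  The programme's `thetaModulus_explicit` is this theorem at `L = lHi d`, `η = eta1 d` once
S-T3 lands.  MEMO-LEVEL programme; an explicit function tending to 0 and nothing more.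
builds on p205010 (kernel theorem, internal audit signed; external expert review pending). -/
theorem thetaModulusNearCritical_of_scaleDefect (hd : 2 ≤ d) {L : ℕ → ℕ} {η : ℝ}
    (h : Quant.ScaleDefectAt d (criticalProbI d) L η) (hη0 : 0 < η) (hη1 : η ≤ 1) (hL : ∀ m, m ≤ L m) :
    Quant.ThetaModulusNearCritical d (fun t =>
      if t ≤ (1 - (criticalProbI d : ℝ)) / 2 then
        ⨅ n : ℕ, (Real.sqrt ((1 - η) ^ Quant.iterCount L (n + 1)) +
          t * Real.sqrt ((((box d (n + 1)).sym2.filter (· ∈ (zdGraph d).edgeSet)).card : ℝ) /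
            (2 * (criticalProbI d : ℝ) * (1 - criticalProbI d)))) ^ 2
      else 1) := by
  have hmain := thetaModulusNearCritical_of_oneArmRate hd (oneArmRateAtCritical_of_scaleDefect h hη0 hη1 hL)
  simpa only using hmain

/-- **One scale, fully explicit** (no infimum): under the same hypotheses, for `p_c ≤ p ≤ (1+p_c)/2` and every `n ≥ 1`,
`θ(p) ≤ ( √((1−η)^{iterCount L n}) + (p − p_c)·√(#E(Λ_n)/(2p_c(1−p_c))) )²`.  MEMO-LEVEL programme; conditional on the scale defect.
builds on p205010 (kernel theorem, internal audit signed; external expert review pending). -/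
theorem theta_le_sq_of_scaleDefect (hd : 2 ≤ d) {L : ℕ → ℕ} {η : ℝ}
    (h : Quant.ScaleDefectAt d (criticalProbI d) L η) (hL : ∀ m, m ≤ L m)
    (p : unitInterval) (hpc : (criticalProbI d : ℝ) ≤ p) (hp : (p : ℝ) ≤ (1 + criticalProbI d) / 2) (n : ℕ) :
    theta (zdGraph d) 0 p ≤ (Real.sqrt ((1 - η) ^ Quant.iterCount L n) +
      ((p : ℝ) - criticalProbI d) *
        Real.sqrt ((((box d n).sym2.filter (· ∈ (zdGraph d).edgeSet)).card : ℝ) /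
          (2 * (criticalProbI d : ℝ) * (1 - criticalProbI d)))) ^ 2 := by
  refine (theta_le_sq_sqrt_oneArm_critical hd p hpc hp n).trans (pow_le_pow_left₀ (by positivity) ?_ 2)
  have hs : 0 ≤ (p : ℝ) - criticalProbI d := by linarith
  have hπ : Real.sqrt (oneArmProb d (criticalProbI d) n) ≤ Real.sqrt ((1 - η) ^ Quant.iterCount L n) :=
    Real.sqrt_le_sqrt (Quant.oneArmRate_of_scaleDefect h hL n)
  linarith

end ThetaModulus

end Summit.CriticalPhenomena.PercolationContinuityZ3.Theorems
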